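import Summits.AnomalousDissipation.AnomalousDissipation.Theorems.BaireTransferDenseLoudDesignerForcesErgodicPeriodicOrbitB
import Literature.Analysis.FluidPDE.LongTimeAveragePeriodic
import Mathlib.Topology.Algebra.Order.Archimedean

/-!
# Certificate `cert_loudTrajectory_of_periodicWitness` of the line `ergodic-budget-selection-closing`
# (crux `BaireTransfer.DenseLoudDesignerForces`, stmt-AnomalousDissipation-1143)

Sorry-free discharge of the registered CERTIFICATE stub `cert_loudTrajectory_of_periodicWitness` of the lead's skeleton
(`Cruxes/DenseLoudDesignerForces/Lines/ergodic_budget_selection_closing.lean`, v10).  It is the converse sandwich of the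
sibling certificate `cert_denseLoudLerayHopfForces_of_loudTrajectories`: a LOUD `τ`-PERIODIC CLASSICAL WITNESS `(u, p)` of the
crux (classical solution of NS_ν(f_c) on `ℝ × T³`, `τ`-periodic, mean-zero slices, `meanEnergy u ≤ E`, `ε ≤ meanDissipation ν u`)
IS an NS phase with a loud trajectory — the line's physics residual Stub 1′ minus its hyperbolicity clause — after relaxing the
budgets by any slack `E < E'`, `ε' < ε`.

**Proof.**  The additive group of time periods of `u` is either generated by a least positive period `τ₀` or dense in `ℝ`
(`AddSubgroup.exists_isLeast_pos` / `AddSubgroup.dense_of_not_isolated_zero`).  In the first case the landed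
`exists_isNSPhase_of_periodic` (part B of the periodic-orbit entry) makes the orbit `K = {stateOf (u t)}` with its rotation
semiflow `φ` an NS phase with `φ_s (stateOf (u 0)) = stateOf (u s)` (`s ≥ 0`).  In the second case the period set is closed
(the state curve `t ↦ stateOf (u t)` is continuous in `H`, `continuous_stateOf_slice`, and determines the slices,
`eq_of_stateOf_eq`), hence all of `ℝ`: `u` is constant in time and the singleton `{stateOf (u 0)}` with the identity semiflow
is an NS phase whose (constant) trajectory is `(u, p)` itself.  In both cases the trajectory of `x = stateOf (u 0)` reads
`stateOf (u s)` for `s ≥ 0`, so `energyAvg φ x T = T⁻¹∫₀ᵀ∫‖u‖²` and `dissipAvg ν φ x T = T⁻¹∫₀ᵀ ν‖∇u‖₂²` (`norm_stateOf_sq`,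
`rep_stateOf`), the Cesàro means of `τ`-periodic functions of time, which converge to the period means
(`tendsto_timeMean_atTop_of_periodic`), i.e. to `meanEnergy u ≤ E < E'` and `meanDissipation ν u ≥ ε > ε'`
(`meanEnergy_eq_of_periodic`, `meanDissipation_eq_of_periodic`); hence eventually `energyAvg φ x T ≤ E'` and eventually (so
frequently) `ε' ≤ dissipAvg ν φ x T`.

References: Foias–Manley–Rosa–Temam, *Navier–Stokes Equations and Turbulence* (CUP 2001) Ch. IV §2 (invariant measures carried
by steady states and periodic orbits; time averages); C. R. Doering, C. Foias, J. Fluid Mech. 467 (2002) §2 (the functionals);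
A. Cheskidov, arXiv:2311.04182 (2023) §6 (long-time averages of time-periodic solutions are period averages).
-/

-- `Summit.<Summit>.<Problem>` is the tree's mandated summit-side namespace (CONVENTIONS §2); for this
-- single-conjunct summit the two coincide, so the duplicate is deliberate.
set_option linter.dupNamespace false

noncomputable section

open scoped BigOperators Topology ENNReal InnerProductSpace
open Filter Set Function MeasureTheory

namespace Summit.AnomalousDissipation.AnomalousDissipation.Theorems.DenseLoudDesignerForces.Ergodic

open Literature.Analysis.FunctionSpaces Literature.Analysis.FunctionSpaces.Torus
open Literature.Analysis.FluidPDE Literature.Analysis.FluidPDE.Torus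
open Summit.AnomalousDissipation.AnomalousDissipation.Theses.BaireTransfer
open Summit.AnomalousDissipation.AnomalousDissipation.Theorems.DenseLoudDesignerForces.Negative

/-! ## Periods of a periodic function: least positive period or dense -/

/-- **Dichotomy for the periods of a periodic function of a real variable.**  If `g` has a period `τ > 0`, then either `g`
has a LEAST positive period `τ₀` (so no `T' ∈ (0, τ₀)` is a period), or the set of periods of `g` is dense in `ℝ` (the
additive group of periods is a nontrivial subgroup of the archimedean group `ℝ`). [folklore] -/
theorem certEntry_minimal_period_or_dense {α : Type*} {g : ℝ → α} {τ : ℝ} (hτ : 0 < τ) (hper : Periodic g τ) :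
    (∃ τ₀ : ℝ, 0 < τ₀ ∧ Periodic g τ₀ ∧ ∀ T', 0 < T' → T' < τ₀ → ¬ Periodic g T') ∨ Dense {T : ℝ | Periodic g T} := by
  -- the additive subgroup of periods
  let P : AddSubgroup ℝ :=
    { carrier := {T | Periodic g T}
      zero_mem' := periodic_with_period_zero g
      add_mem' := fun h₁ h₂ => h₁.add_period h₂
      neg_mem' := fun h => h.neg }
  have hP : (P : Set ℝ) = {T | Periodic g T} := rfl
  by_cases h : ∃ δ : ℝ, 0 < δ ∧ Disjoint (P : Set ℝ) (Ioo 0 δ)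
  · obtain ⟨δ, hδ, hd⟩ := h
    have hbot : P ≠ ⊥ := by
      intro hb
      have hτP : τ ∈ P := hper
      rw [hb, AddSubgroup.mem_bot] at hτP
      exact hτ.ne' hτP
    obtain ⟨a, ⟨haP, ha0⟩, hmin⟩ := AddSubgroup.exists_isLeast_pos hbot hδ hd
    exact Or.inl ⟨a, ha0, haP, fun T' h0 hlt hT' => (hmin ⟨hT', h0⟩).not_gt hlt⟩
  · push Not at h
    refine Or.inr (hP ▸ AddSubgroup.dense_of_not_isolated_zero P fun δ hδ => ?_)
    obtain ⟨T, hTP, hT⟩ := Set.not_disjoint_iff.1 (h δ hδ)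
    exact ⟨T, hTP, hT⟩

/-! ## The degenerate case: a classical solution with a dense set of periods is steady -/

section Steady

variable {ν : ℝ} {F : (UnitAddTorus (Fin 3)) → (EuclideanSpace ℝ (Fin 3))}
  {u : ℝ → (UnitAddTorus (Fin 3)) → (EuclideanSpace ℝ (Fin 3))} {p : ℝ → (UnitAddTorus (Fin 3)) → ℝ}

/-- **A classical solution with a dense set of time periods is constant in time** (steady force, mean-zero slices): the set
of periods is closed, because the state curve `t ↦ stateOf (u t)` is continuous in `H` and determines the slices, so it is
all of `ℝ`. [folklore] -/
theorem certEntry_slice_eq_of_dense (hsol : IsClassicalNSSolutionOn univ ν (fun _ => F) u p) (hmean : ∀ t, HasZeroMean (u t))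
    (hdense : Dense {T : ℝ | Periodic u T}) (t : ℝ) : u t = u 0 := by
  have hs := isSmooth_slice_of_univ hsol
  have hd : ∀ t, IsDivFree (u t) := fun t => hsol.divFree t (mem_univ t)
  have hstc : Continuous fun t : ℝ => stateOf (u t) := continuous_stateOf_slice hsol hmean
  have hclosed : IsClosed {T : ℝ | Periodic u T} := by
    have heq : {T : ℝ | Periodic u T} = ⋂ s : ℝ, {T : ℝ | stateOf (u (s + T)) = stateOf (u s)} := by
      ext T
      simp only [mem_setOf_eq, mem_iInter]
      exact ⟨fun h s => by rw [h s], fun h s => eq_of_stateOf_eq (hs _) (hd _) (hmean _) (hs _) (hd _) (hmean _) (h s)⟩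
    rw [heq]
    exact isClosed_iInter fun s => isClosed_eq (hstc.comp (continuous_const_add s)) continuous_const
  have ht : t ∈ {T : ℝ | Periodic u T} := by
    rw [← hclosed.closure_eq, hdense.closure_eq]
    exact mem_univ t
  simpa only [zero_add] using ht 0

/-- **The trivial NS phase of a time-constant classical solution.**  If the classical solution `(u, p)` of NS_ν(F) on `ℝ × T³`
(mean-zero slices) is constant in time, the singleton `{stateOf (u 0)}` with the identity semiflow is an NS phase, whose
trajectory is `(u, p)` restricted to `[0, ∞)`. [folklore] -/
theorem certEntry_isNSPhase_singleton_of_slice_eq (hsol : IsClassicalNSSolutionOn univ ν (fun _ => F) u p)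
    (hmean : ∀ t, HasZeroMean (u t)) (hconst : ∀ t, u t = u 0) : IsNSPhase ν F {stateOf (u 0)} (fun _ y => y) := by
  have hs := isSmooth_slice_of_univ hsol
  have hd : ∀ t, IsDivFree (u t) := fun t => hsol.divFree t (mem_univ t)
  have hrep : rep (stateOf (u 0)) =ᵐ[volume] u 0 := rep_stateOf (hs 0) (hd 0) (hmean 0)
  refine
    { isCompact := isCompact_singleton
      mapsTo := fun t _ y hy => hy
      map_zero := fun y _ => rfl
      map_add := fun s t _ _ y _ => rfl
      continuousOn := continuous_snd.continuousOn
      enstrophy_finite := fun y hy => ?_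
      enstrophy_continuousOn := (subsingleton_singleton (a := stateOf (u 0))).continuousOn _
      trajectory := fun y hy => ?_ }
  · rw [mem_singleton_iff.1 hy, Literature.Analysis.FluidPDE.eGradNormSq_congr_ae hrep]
    exact (eGradNormSq_lt_top (hs 0)).ne
  · rw [mem_singleton_iff.1 hy]
    refine ⟨u, p, hsol.mono (subset_univ _) (uniqueDiffOn_Ici 0), fun t _ => ?_⟩
    rw [hconst t]
    exact hrep

end Steady

/-! ## The NS phase of a periodic classical witness and the loudness transfer -/

section Witness

variable {ν : ℝ} {F : (UnitAddTorus (Fin 3)) → (EuclideanSpace ℝ (Fin 3))}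
  {u : ℝ → (UnitAddTorus (Fin 3)) → (EuclideanSpace ℝ (Fin 3))} {p : ℝ → (UnitAddTorus (Fin 3)) → ℝ}

/-- **The NS phase through the initial state of a periodic classical solution.**  For a classical solution `(u, p)` of NS_ν(F)
on `ℝ × T³` (`ν > 0`, steady force, mean-zero slices) with a period `τ > 0` there is an NS phase `(K, φ)` containing
`x = stateOf (u 0)` whose trajectory is the state curve: `φ_s x = stateOf (u s)` for `s ≥ 0` (the orbit with its rotation
semiflow when `u` has a least positive period, `exists_isNSPhase_of_periodic`; the steady singleton otherwise). [folklore] -/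
theorem certEntry_exists_isNSPhase (hν : 0 < ν) (hsol : IsClassicalNSSolutionOn univ ν (fun _ => F) u p)
    (hmean : ∀ t, HasZeroMean (u t)) {τ : ℝ} (hτ : 0 < τ) (hper : Periodic u τ) :
    ∃ (K : Set Hsp) (φ : ℝ → Hsp → Hsp), IsNSPhase ν F K φ ∧ stateOf (u 0) ∈ K ∧
      ∀ s : ℝ, 0 ≤ s → φ s (stateOf (u 0)) = stateOf (u s) := by
  rcases certEntry_minimal_period_or_dense hτ hper with ⟨τ₀, hτ₀, hper₀, hmin⟩ | hdense
  · obtain ⟨φ, hK, hφ⟩ := exists_isNSPhase_of_periodic hν.le hsol hmean hτ₀ hper₀ hmin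
    exact ⟨_, φ, hK, mem_range_self (0 : ℝ), fun s hs0 => by rw [hφ 0 s hs0, zero_add]⟩
  · have hconst : ∀ t, u t = u 0 := certEntry_slice_eq_of_dense hsol hmean hdense
    exact ⟨{stateOf (u 0)}, fun _ y => y, certEntry_isNSPhase_singleton_of_slice_eq hsol hmean hconst, mem_singleton _,
      fun s _ => by rw [hconst s]⟩

/-- **Loudness transfer from the witness to its trajectory.**  If `φ_s (stateOf (u 0)) = stateOf (u s)` for `s ≥ 0` along a
`τ`-periodic classical solution `(u, p)` (mean-zero slices) with `meanEnergy u ≤ E < E'` and `ε' < ε ≤ meanDissipation ν u`,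
then eventually `energyAvg φ (stateOf (u 0)) T ≤ E'` and frequently `ε' ≤ dissipAvg ν φ (stateOf (u 0)) T`: the trajectory
means are the Cesàro means of the `τ`-periodic functions `∫‖u(t)‖²`, `ν‖∇u(t)‖₂²`, which converge to the period means, i.e. to
`meanEnergy u` and `meanDissipation ν u`. [folklore] -/
theorem certEntry_loud_of_periodic (hsol : IsClassicalNSSolutionOn univ ν (fun _ => F) u p) (hmean : ∀ t, HasZeroMean (u t))
    {τ : ℝ} (hτ : 0 < τ) (hper : Periodic u τ) {φ : ℝ → Hsp → Hsp}
    (hφ : ∀ s : ℝ, 0 ≤ s → φ s (stateOf (u 0)) = stateOf (u s)) {E ε E' ε' : ℝ} (hE : meanEnergy u ≤ E)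
    (hε : ε ≤ meanDissipation ν u) (hEE' : E < E') (hε'ε : ε' < ε) :
    (∀ᶠ T in atTop, energyAvg φ (stateOf (u 0)) T ≤ E') ∧ (∃ᶠ T in atTop, ε' ≤ dissipAvg ν φ (stateOf (u 0)) T) := by
  have hs := isSmooth_slice_of_univ hsol
  have hd : ∀ t, IsDivFree (u t) := fun t => hsol.divFree t (mem_univ t)
  constructor
  · -- energy: `energyAvg φ x T` is the Cesàro mean of the `τ`-periodic `t ↦ ∫‖u t‖²`, which tends to `meanEnergy u`
    have hgper : Periodic (fun t => ∫ y, ‖u t y‖ ^ 2) τ := fun t => by simp only [hper t]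
    have hlim : Tendsto (timeMean fun t => ∫ y, ‖u t y‖ ^ 2) atTop (𝓝 (meanEnergy u)) := by
      rw [meanEnergy_eq_of_periodic hper hτ]
      exact tendsto_timeMean_atTop_of_periodic hgper hτ
    have hev : ∀ᶠ T in atTop, timeMean (fun t => ∫ y, ‖u t y‖ ^ 2) T ≤ E' :=
      hlim.eventually_le_const (hE.trans_lt hEE')
    filter_upwards [hev, eventually_gt_atTop (0 : ℝ)] with T hT hT0
    have heq : energyAvg φ (stateOf (u 0)) T = timeMean (fun t => ∫ y, ‖u t y‖ ^ 2) T := by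
      unfold energyAvg timeMean
      congr 1
      refine intervalIntegral.integral_congr fun s hs0 => ?_
      rw [uIcc_of_le hT0.le] at hs0
      show ‖φ s (stateOf (u 0))‖ ^ 2 = ∫ y, ‖u s y‖ ^ 2
      rw [hφ s hs0.1, norm_stateOf_sq (hs s) (hd s) (hmean s)]
    rw [heq]
    exact hT
  · -- dissipation: `dissipAvg ν φ x T` is the Cesàro mean of the `τ`-periodic `t ↦ ν‖∇u t‖₂²`, which tends to `meanDissipation ν u`
    have hgper : Periodic (fun t => ν * (eGradNormSq (u t)).toReal) τ := fun t => by simp only [hper t]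
    have hlim : Tendsto (timeMean fun t => ν * (eGradNormSq (u t)).toReal) atTop (𝓝 (meanDissipation ν u)) := by
      rw [meanDissipation_eq_of_periodic hper hτ]
      exact tendsto_timeMean_atTop_of_periodic hgper hτ
    have hev : ∀ᶠ T in atTop, ε' ≤ timeMean (fun t => ν * (eGradNormSq (u t)).toReal) T :=
      hlim.eventually_const_le (hε'ε.trans_le hε)
    refine Filter.Eventually.frequently ?_
    filter_upwards [hev, eventually_gt_atTop (0 : ℝ)] with T hT hT0
    have heq : dissipAvg ν φ (stateOf (u 0)) T = timeMean (fun t => ν * (eGradNormSq (u t)).toReal) T := by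
      unfold dissipAvg timeMean
      congr 1
      refine intervalIntegral.integral_congr fun s hs0 => ?_
      rw [uIcc_of_le hT0.le] at hs0
      show ν * enstrophyObs (φ s (stateOf (u 0))) = ν * (eGradNormSq (u s)).toReal
      rw [hφ s hs0.1]
      unfold enstrophyObs
      rw [Literature.Analysis.FluidPDE.eGradNormSq_congr_ae (rep_stateOf (hs s) (hd s) (hmean s))]
    rw [heq]
    exact hT

end Witness

/-! ## The registered certificate -/

/-- **Registered certificate stub `cert_loudTrajectory_of_periodicWitness` (line `ergodic-budget-selection-closing`, crux
stmt-AnomalousDissipation-1143): a loud periodic classical witness of the crux is an NS phase with a loud trajectory.**  Let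
`(u, p)` be a classical solution of NS_ν(f_c) on `ℝ × T³` (`ν > 0`, `f_c = force S c`) with mean-zero slices and a period
`τ > 0`, with `meanEnergy u ≤ E` and `ε ≤ meanDissipation ν u`.  Then for every slack `E < E'`, `ε' < ε` there is an NS phase
`(K, φ)` of NS_ν(f_c) with a point `x ∈ K` whose trajectory is loud: eventually `energyAvg φ x T ≤ E'` and frequently
`ε' ≤ dissipAvg ν φ x T` — the H-free form of the line's residual Stub 1′ for this force.  `K` is the orbit of the state curve
(or the steady singleton), `x = stateOf (u 0)` (`certEntry_exists_isNSPhase`), and the budgets transfer because the trajectory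
means are Cesàro means of `τ`-periodic functions converging to `meanEnergy u`, `meanDissipation ν u`
(`certEntry_loud_of_periodic`; Foias–Manley–Rosa–Temam 2001 Ch. IV §2, Doering–Foias 2002 §2). -/
theorem cert_loudTrajectory_of_periodicWitness : ∀ {S : Finset (Fin 3 → ℤ)} {c : ↥S → (EuclideanSpace ℂ (Fin 3))} {ν : ℝ} {u : ℝ → (UnitAddTorus (Fin 3)) → (EuclideanSpace ℝ (Fin 3))} {p : ℝ → (UnitAddTorus (Fin 3)) → ℝ} {τ E ε : ℝ}, 0 < ν → 0 < τ → IsClassicalNSSolutionOn univ ν (fun _ => force S c) u p → Function.Periodic u τ → (∀ t, HasZeroMean (u t)) → meanEnergy u ≤ E → ε ≤ meanDissipation ν u → ∀ {E' ε' : ℝ}, E < E' → ε' < ε → ∃ (K : Set Hsp) (φ : ℝ → Hsp → Hsp), IsNSPhase ν (force S c) K φ ∧ ∃ x ∈ K, (∀ᶠ T in atTop, energyAvg φ x T ≤ E') ∧ (∃ᶠ T in atTop, ε' ≤ dissipAvg ν φ x T) := by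
  intro S c ν u p τ E ε hν hτ hsol hper hmean hE hε E' ε' hEE' hε'ε
  obtain ⟨K, φ, hK, hx, hφ⟩ := certEntry_exists_isNSPhase hν hsol hmean hτ hper
  exact ⟨K, φ, hK, stateOf (u 0), hx, certEntry_loud_of_periodic hsol hmean hτ hper hφ hE hε hEE' hε'ε⟩

end Summit.AnomalousDissipation.AnomalousDissipation.Theorems.DenseLoudDesignerForces.Ergodic

end
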